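import Mathlib
import Literature.Analysis.FluidPDE.Tao2016AveragedNS.ShiftSetCascadeFlux
import HarnessLib

/-!
# Shift-set pseudo-flows (`PseudoFlowOnShift 𝕊`): the motion law (4.8) in integral form (helper for item
  stmt-NavierStokesRegularity-22988 `GappedFrontRobustV2Flat`, crux K_B♭ of route TaoLadderRungTwoFlat)

The `𝕊`-parametrised versions, for an ARBITRARY shift set `𝕊`, of the integral-form motion laws of
`Theorems/TaoLadderRungThreeGappedFrontRobustComparison.lean` (p1 g9, one-way `S`): continuity of
`t ↦ quadTermOn(S)_{i,k}(t)` along a pseudo-flow (tree: `continuousOn_quadTermOn`), the motion law with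
defect in integral form `|S(s) − S₀ − ∫₀ˢ quadTermOn(S)| ≤ ∫₀ˢ κ₁ (1+ε₀)^{2k} √F` (FTC for the one-sided
derivative within `[0,τ]`), its exact case, and the integral form for the difference of a pseudo-flow and
an exact flow. Proofs verbatim with `quadTerm ↦ quadTermOn 𝕊`. (`bootstrap_family` of the `S` file is
table-free and is reused as is.)

HONEST FRAMING: elementary bookkeeping about Tao-type MODEL lattice pseudo-flows on a general shift set
(Tao 2016 §4 Lemma 4.1 (4.5), (4.8)); nothing here is a statement about the Navier–Stokes equations, and
nothing is asserted about any table. Third table-generic layer of the S♭ port of K_B₂ (p1 g11).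
-/

noncomputable section

-- the sub-problem namespace `Summit.NavierStokesRegularity.NavierStokesRegularity` repeats the summit name by design (D-0017)
set_option linter.dupNamespace false

namespace Summit.NavierStokesRegularity.NavierStokesRegularity.Theorems

open Set MeasureTheory intervalIntegral Literature.Analysis.FluidPDE Literature.Analysis.FluidPDE.TaoCascade

namespace GappedFrontRobustOn

variable {m : ℕ} {𝕊 : Finset (ℤ × ℤ × ℤ)}
variable {τ ε₀ : ℝ} {α : Fin m → Fin m → Fin m → ℤ × ℤ × ℤ → ℝ} {κ₁ κ₂ κ₂' : ℝ}
  {S₀ F₀ B₀ S₀' F₀' B₀' : Fin m → ℤ → ℝ} {S F S' F' : Fin m → ℤ → ℝ → ℝ}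

/-! ### The motion law in integral form -/

/-- Along a pseudo-flow the quadratic terms `t ↦ quadTermOn(S)_{i,k}(t)` are continuous on `[0, τ]`
(finite sums of products of the `C¹` amplitudes). [cite: Tao2016AveragedNS, §4 Lemma 4.1 (4.5), (4.8)] -/
theorem pseudoFlowOnShift_continuousOn_quadTermOn (h : PseudoFlowOnShift 𝕊 τ ε₀ α κ₁ κ₂ S₀ F₀ B₀ S F) (i : Fin m)
    (k : ℤ) : ContinuousOn (fun t => quadTermOn 𝕊 ε₀ α S i k t) (Icc 0 τ) :=
  continuousOn_quadTermOn 𝕊 ε₀ α (fun i n => (h.contDiffOn_S i n).continuousOn) i k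

/-- **The motion law (4.8) in integral form.** Along a pseudo-flow on `[0, τ]` (`τ > 0`) with motion
defect constant `κ₁`, for every mode, shell and `s ∈ [0, τ]`,
`|S_{i,k}(s) − S₀_{i,k} − ∫₀^s quadTerm(S)_{i,k}(u) du| ≤ ∫₀^s κ₁ (1+ε₀)^{2k} √(F_{i,k}(u)) du`.
[cite: Tao2016AveragedNS, §4 Lemma 4.1 (4.8)] -/
theorem pseudoFlowOnShift_motion_integral (h : PseudoFlowOnShift 𝕊 τ ε₀ α κ₁ κ₂ S₀ F₀ B₀ S F) (hτ : 0 < τ)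
    (i : Fin m) (k : ℤ) {s : ℝ} (hs : s ∈ Icc 0 τ) :
    |S i k s - S₀ i k - ∫ u in (0 : ℝ)..s, quadTermOn 𝕊 ε₀ α S i k u| ≤
      ∫ u in (0 : ℝ)..s, κ₁ * (1 + ε₀) ^ ((2 : ℝ) * k) * Real.sqrt (F i k u) := by
  have hsubI : Icc 0 s ⊆ Icc 0 τ := Icc_subset_Icc_right hs.2
  have hsub : uIcc 0 s ⊆ Icc 0 τ := by rwa [uIcc_of_le hs.1]
  have hf := h.contDiffOn_S i k
  have hcont : ContinuousOn (S i k) (Icc 0 s) := hf.continuousOn.mono hsubI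
  have hf'cont : ContinuousOn (derivWithin (S i k) (Icc 0 τ)) (Icc 0 τ) :=
    hf.continuousOn_derivWithin (uniqueDiffOn_Icc hτ) le_rfl
  have hderiv : ∀ x ∈ Ioo 0 s, HasDerivAt (S i k) (derivWithin (S i k) (Icc 0 τ) x) x := by
    intro x hx
    have hxτ : x < τ := hx.2.trans_le hs.2
    have hxI : Icc 0 τ ∈ nhds x := Icc_mem_nhds hx.1 hxτ
    have hd : DifferentiableWithinAt ℝ (S i k) (Icc 0 τ) x :=
      (hf.differentiableOn one_ne_zero) x ⟨hx.1.le, hxτ.le⟩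
    rw [derivWithin_of_mem_nhds hxI]
    exact (hd.differentiableAt hxI).hasDerivAt
  have hint' : IntervalIntegrable (derivWithin (S i k) (Icc 0 τ)) volume 0 s :=
    (hf'cont.mono hsub).intervalIntegrable
  have hqint : IntervalIntegrable (fun u => quadTermOn 𝕊 ε₀ α S i k u) volume 0 s :=
    ((pseudoFlowOnShift_continuousOn_quadTermOn h i k).mono hsub).intervalIntegrable
  have hdcont : ContinuousOn (fun u => κ₁ * (1 + ε₀) ^ ((2 : ℝ) * k) * Real.sqrt (F i k u))
      (Icc 0 τ) := continuousOn_const.mul (h.contDiffOn_F i k).continuousOn.sqrt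
  have hdint : IntervalIntegrable (fun u => κ₁ * (1 + ε₀) ^ ((2 : ℝ) * k) * Real.sqrt (F i k u))
      volume 0 s := (hdcont.mono hsub).intervalIntegrable
  have hftc := intervalIntegral.integral_eq_sub_of_hasDerivAt_of_le hs.1 hcont hderiv hint'
  rw [h.init_S i k] at hftc
  have heq : S i k s - S₀ i k - ∫ u in (0 : ℝ)..s, quadTermOn 𝕊 ε₀ α S i k u =
      ∫ u in (0 : ℝ)..s, (derivWithin (S i k) (Icc 0 τ) u - quadTermOn 𝕊 ε₀ α S i k u) := by
    rw [intervalIntegral.integral_sub hint' hqint, hftc]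
  rw [heq]
  calc |∫ u in (0 : ℝ)..s, (derivWithin (S i k) (Icc 0 τ) u - quadTermOn 𝕊 ε₀ α S i k u)|
      ≤ ∫ u in (0 : ℝ)..s, |derivWithin (S i k) (Icc 0 τ) u - quadTermOn 𝕊 ε₀ α S i k u| :=
        intervalIntegral.abs_integral_le_integral_abs hs.1
    _ ≤ ∫ u in (0 : ℝ)..s, κ₁ * (1 + ε₀) ^ ((2 : ℝ) * k) * Real.sqrt (F i k u) :=
        intervalIntegral.integral_mono_on hs.1 (hint'.sub hqint).abs hdint
          fun u hu => h.motion i k u (hsubI hu)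

/-- **Exact flows solve the motion law exactly**: for a defect-free flow (`κ₁ = 0`),
`S_{i,k}(s) = S₀_{i,k} + ∫₀^s quadTerm(S)_{i,k}` on `[0, τ]`. [cite: Tao2016AveragedNS, §4 Lemma 4.1 (4.8)] -/
theorem pseudoFlowOnShift_exact_motion_integral (h : PseudoFlowOnShift 𝕊 τ ε₀ α 0 κ₂ S₀ F₀ B₀ S F) (hτ : 0 < τ)
    (i : Fin m) (k : ℤ) {s : ℝ} (hs : s ∈ Icc 0 τ) :
    S i k s = S₀ i k + ∫ u in (0 : ℝ)..s, quadTermOn 𝕊 ε₀ α S i k u := by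
  have h1 := pseudoFlowOnShift_motion_integral h hτ i k hs
  simp only [zero_mul, intervalIntegral.integral_zero] at h1
  have h2 := abs_nonpos_iff.mp h1
  linarith

/-- **Difference of a pseudo-flow and an exact flow, integral form**: if `S` is a pseudo-flow with
motion defect `κ₁` and `S'` a defect-free flow for the same table on `[0, τ]`, then
`|(S − S')_{i,k}(s) − (S₀ − S₀')_{i,k} − ∫₀^s (quadTerm(S) − quadTerm(S'))_{i,k}| ≤ ∫₀^s κ₁ (1+ε₀)^{2k} √F_{i,k}`.
[cite: Tao2016AveragedNS, §4 Lemma 4.1 (4.8)] -/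
theorem pseudoFlowOnShift_diff_integral (h : PseudoFlowOnShift 𝕊 τ ε₀ α κ₁ κ₂ S₀ F₀ B₀ S F)
    (h' : PseudoFlowOnShift 𝕊 τ ε₀ α 0 κ₂' S₀' F₀' B₀' S' F') (hτ : 0 < τ)
    (i : Fin m) (k : ℤ) {s : ℝ} (hs : s ∈ Icc 0 τ) :
    |(S i k s - S' i k s) - (S₀ i k - S₀' i k) -
        ∫ u in (0 : ℝ)..s, (quadTermOn 𝕊 ε₀ α S i k u - quadTermOn 𝕊 ε₀ α S' i k u)| ≤
      ∫ u in (0 : ℝ)..s, κ₁ * (1 + ε₀) ^ ((2 : ℝ) * k) * Real.sqrt (F i k u) := by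
  have hsub : uIcc 0 s ⊆ Icc 0 τ := by
    rw [uIcc_of_le hs.1]
    exact Icc_subset_Icc_right hs.2
  have hqint : IntervalIntegrable (fun u => quadTermOn 𝕊 ε₀ α S i k u) volume 0 s :=
    ((pseudoFlowOnShift_continuousOn_quadTermOn h i k).mono hsub).intervalIntegrable
  have hqint' : IntervalIntegrable (fun u => quadTermOn 𝕊 ε₀ α S' i k u) volume 0 s :=
    ((pseudoFlowOnShift_continuousOn_quadTermOn h' i k).mono hsub).intervalIntegrable
  have h1 := pseudoFlowOnShift_motion_integral h hτ i k hs
  have h2 := pseudoFlowOnShift_exact_motion_integral h' hτ i k hs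
  rw [intervalIntegral.integral_sub hqint hqint']
  have heq : (S i k s - S' i k s) - (S₀ i k - S₀' i k) -
      ((∫ u in (0 : ℝ)..s, quadTermOn 𝕊 ε₀ α S i k u) - ∫ u in (0 : ℝ)..s, quadTermOn 𝕊 ε₀ α S' i k u) =
      S i k s - S₀ i k - ∫ u in (0 : ℝ)..s, quadTermOn 𝕊 ε₀ α S i k u := by
    rw [h2]
    ring
  rw [heq]
  exact h1

end GappedFrontRobustOn

end Summit.NavierStokesRegularity.NavierStokesRegularity.Theorems

end
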